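import Summits.BirchSwinnertonDyer.BirchSwinnertonDyer.Theorems.EisensteinPrimesLineCharactersAtMultiplicativePlace
import Summits.BirchSwinnertonDyer.Rank1Residual.X2.LocalDeltaCalculus
import HarnessLib

/-!
# Crux 3 `MazurMCOnCellB` (stmt-BirchSwinnertonDyer-19033), line `twistback` v4 — brick (F3′), sequel:
# the KL-flat door's LOCAL BALANCE TERM at a multiplicative place `ℓ ≠ p` is `δ^{(ℓ)} + s_ℓ` (split)
# and `δ^{(ℓ)}` (non-split)

Width seat bsd-line-x2-p1-w7 (g0). HONEST FRAMING (cell `bsd-eis`, run/shared/lean/pub/bsd-eis/): TOOL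
THEOREMS ONLY (no `def`, no named fact, no `sorry`); every input a tree THEOREM; nothing booked; no
main conjecture / BSD proved for any curve; no summit statement is proved; 0 cells / labels move.

WHAT. The balance term of `…TwistbackKLFlatPartner{,Units,UnitsPsi}` at a place `v = (ℓ)`,
`s_ℓ·[φ(ℓ) = ℓ̄] + s_ℓ·[ψ(ℓ) = ℓ̄]` (VERBATIM the summand of their `hbal`), evaluated BY REDUCTION TYPE
from `…LineCharactersAtMultiplicativePlace` §3 and the tree's `d_ℓ` calculus
(`X2/LocalDeltaCalculus`: `d_ℓ = [ℓ ≡ 1]` split, `[ℓ ≡ −1]` non-split; `δ = s_ℓ d_ℓ`):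
* `balanceTerm_of_hasSplitMultiplicativeReductionAt` — SPLIT `ℓ ≠ p`: term `= δ_W^{(v)} + s_ℓ`;
* `balanceTerm_of_not_hasSplitMultiplicativeReductionAtPrime` — NON-split odd `ℓ ≠ p`, `p` odd,
  `W` globally minimal: term `= δ_W^{(v)}`;
* `balanceTerm_of_hasAdditiveReductionAt_of_dvd` — ADDITIVE `v` with both characters ramified
  (`ℓ ∣ m`, `ℓ ∣ d`): term `= δ_W^{(v)} = 0`; `balance_iff_of_forall_term_eq` — the sum over `S₀`:
  `n + Σ δ = Σ term ↔ n = Σ e` once `term(v) = δ(v) + e(v)` pointwise.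
So over the multiplicative places of `S₀` the door's balance `1 + Σ δ = Σ (terms)` reads
`1 = Σ_{split ℓ ∈ S₀} s_ℓ + (additive places' terms)` — the kernel form of the cell's desk formula
`c(E) = Σ_{ℓ ‖ N, ℓ ≠ p, split} s_ℓ + …` (LEAD bsd-line-x2-p1 g9/g10, 51/51 on the O9 window).

References: [GreenbergVatsal2000] §2 Prop. (2.4) (p. 22), pp. 14–15, p. 27 (the worked example
`E₁ = 52A1`, `ℓ = 13` non-split, `δ^{(13)} = 0`); [SilvermanAEC2009] VII.5 Prop. 5.1 (b), §C.16.
-/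

set_option autoImplicit false
set_option linter.dupNamespace false

noncomputable section

open scoped Classical Pointwise

open NumberField IsDedekindDomain Field WeierstrassCurve
  Literature.NumberTheory.EllipticCurves Literature.NumberTheory.GaloisRepresentations
  Literature.NumberTheory.EllipticCurves.GreenbergSelmer
  Literature.NumberTheory.EllipticCurves.Rank1Residual
  Literature.NumberTheory.EllipticCurves.GreenbergVatsal2000
  Summit.BirchSwinnertonDyer.Rank1Residual.X2
  Summit.BirchSwinnertonDyer.BirchSwinnertonDyer.Theorems.EisensteinPrimesLinePsiAtMultiplicativePrime
  Summit.BirchSwinnertonDyer.BirchSwinnertonDyer.Theorems.EisensteinPrimesLineCharactersAtMultiplicativePlace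

namespace Summit.BirchSwinnertonDyer.BirchSwinnertonDyer.Theorems.EisensteinPrimesLocalBalanceAtMultiplicativePlace

variable {W : WeierstrassCurve ℚ} [W.IsElliptic] {p : ℕ} [hp : Fact p.Prime]

/-! ## The local balance term of the KL-flat door at a multiplicative place `v ∤ p` -/

/-- **SPLIT multiplicative `v = (ℓ)`, `ℓ ≠ p`: the door's balance term at `v` is `δ_W^{(v)} + s_ℓ`**:
`s_ℓ[φ(ℓ) = ℓ̄] + s_ℓ[ψ(ℓ) = ℓ̄] = δ_W^{(v)} + s_ℓ` (`δ = s_ℓ·d_ℓ`, `d_ℓ = [ℓ ≡ 1 (mod p)]` at a split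
place, `X2/LocalDeltaCalculus`): a split multiplicative prime NETS `s_ℓ` in Greenberg–Vatsal's
`λ`-bookkeeping (GV §2 Prop. (2.4), p. 27). [cite: GreenbergVatsal2000, §2 Prop. (2.4) (p. 22), pp. 14–15 and p. 27] -/
theorem balanceTerm_of_hasSplitMultiplicativeReductionAt {v : HeightOneSpectrum (𝓞 ℚ)}
    (hℓp : Rat.HeightOneSpectrum.natGenerator v ≠ p) (hsplit : W.HasSplitMultiplicativeReductionAt v)
    {Φ₀ : AddSubgroup (geomTorsion W (p : ℤ))} (hΦ : IsRationalLine W p Φ₀)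
    {m : ℕ} [NeZero m] (φ : DirichletCharacter (ZMod p) m) (hℓm : ¬ Rat.HeightOneSpectrum.natGenerator v ∣ m)
    {d : ℕ} [NeZero d] (ψ : DirichletCharacter (ZMod p) d) (hℓd : ¬ Rat.HeightOneSpectrum.natGenerator v ∣ d)
    (hφ0 : ∀ (σ : absoluteGaloisGroup ℚ), ∀ P ∈ Φ₀,
      σ • P = (φ ((modNCyclotomicCharacter ℚ m σ : (ZMod m)ˣ) : ZMod m)).val • P)
    (hψ0 : ∀ (σ : absoluteGaloisGroup ℚ) (Q : geomTorsion W (p : ℤ)),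
      σ • Q - (ψ ((modNCyclotomicCharacter ℚ d σ : (ZMod d)ˣ) : ZMod d)).val • Q ∈ Φ₀) :
    ((if φ (Rat.HeightOneSpectrum.natGenerator v : ZMod m) =
          (Rat.HeightOneSpectrum.natGenerator v : ZMod p)
        then sFactor p (Rat.HeightOneSpectrum.natGenerator v) else 0) +
      (if ψ (Rat.HeightOneSpectrum.natGenerator v : ZMod d) =
          (Rat.HeightOneSpectrum.natGenerator v : ZMod p)
        then sFactor p (Rat.HeightOneSpectrum.natGenerator v) else 0)) =
      delta W p v + sFactor p (Rat.HeightOneSpectrum.natGenerator v) := by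
  set ℓ := Rat.HeightOneSpectrum.natGenerator v with hℓdef
  have key := lineChars_natCast_of_hasSplitMultiplicativeReductionAt (W := W)
    (coe_primesEquiv_eq_natGenerator v) hℓp hsplit hΦ φ hℓm ψ hℓd hφ0 hψ0
  rw [delta_eq, LocalDeltaCalculus.dMultiplicity_of_hasSplitMultiplicativeReductionAt hsplit, ← hℓdef]
  rcases key with ⟨h1, h2⟩ | ⟨h1, h2⟩
  · rw [h1, h2, if_pos rfl]
    by_cases h : (ℓ : ZMod p) = 1
    · rw [if_pos h.symm, if_pos h]; ring
    · rw [if_neg (Ne.symm h), if_neg h]; ring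
  · rw [h1, h2, if_pos rfl]
    by_cases h : (ℓ : ZMod p) = 1
    · rw [if_pos h.symm, if_pos h]; ring
    · rw [if_neg (Ne.symm h), if_neg h]; ring

/-- **NON-SPLIT multiplicative odd `v = (ℓ)`, `ℓ ≠ p`, `p` odd: the door's balance term at `v` is
`δ_W^{(v)}`**: `s_ℓ[φ(ℓ) = ℓ̄] + s_ℓ[ψ(ℓ) = ℓ̄] = δ_W^{(v)}` (`d_ℓ = [ℓ ≡ −1 (mod p)]` at a non-split
place): a non-split multiplicative prime NETS ZERO (GV p. 27: "`ℓ = 13` non-split … `δ^{(13)} = 0`").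
With `balanceTerm_of_hasSplitMultiplicativeReductionAt` this is the kernel form of the desk formula
`c(E) = Σ_{ℓ ‖ N, ℓ ≠ p, split} s_ℓ + (additive terms)` of the cell (LEAD bsd-line-x2-p1 g9/g10).
[cite: GreenbergVatsal2000, §2 Prop. (2.4) (p. 22), pp. 14–15 and p. 27] [cite: SilvermanAEC2009, VII.5 Prop. 5.1(b)] -/
theorem balanceTerm_of_not_hasSplitMultiplicativeReductionAtPrime [W.IsGloballyMinimal] (hp2 : p ≠ 2)
    {v : HeightOneSpectrum (𝓞 ℚ)} [hℓ : Fact (Rat.HeightOneSpectrum.natGenerator v).Prime]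
    (hℓp : Rat.HeightOneSpectrum.natGenerator v ≠ p) (hℓ2 : Rat.HeightOneSpectrum.natGenerator v ≠ 2)
    (hmult : W.HasMultiplicativeReductionAtPrime (Rat.HeightOneSpectrum.natGenerator v))
    (hns : ¬ W.HasSplitMultiplicativeReductionAtPrime (Rat.HeightOneSpectrum.natGenerator v))
    {Φ₀ : AddSubgroup (geomTorsion W (p : ℤ))} (hΦ : IsRationalLine W p Φ₀)
    {m : ℕ} [NeZero m] (φ : DirichletCharacter (ZMod p) m) (hℓm : ¬ Rat.HeightOneSpectrum.natGenerator v ∣ m)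
    {d : ℕ} [NeZero d] (ψ : DirichletCharacter (ZMod p) d) (hℓd : ¬ Rat.HeightOneSpectrum.natGenerator v ∣ d)
    (hφ0 : ∀ (σ : absoluteGaloisGroup ℚ), ∀ P ∈ Φ₀,
      σ • P = (φ ((modNCyclotomicCharacter ℚ m σ : (ZMod m)ˣ) : ZMod m)).val • P)
    (hψ0 : ∀ (σ : absoluteGaloisGroup ℚ) (Q : geomTorsion W (p : ℤ)),
      σ • Q - (ψ ((modNCyclotomicCharacter ℚ d σ : (ZMod d)ˣ) : ZMod d)).val • Q ∈ Φ₀) :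
    ((if φ (Rat.HeightOneSpectrum.natGenerator v : ZMod m) =
          (Rat.HeightOneSpectrum.natGenerator v : ZMod p)
        then sFactor p (Rat.HeightOneSpectrum.natGenerator v) else 0) +
      (if ψ (Rat.HeightOneSpectrum.natGenerator v : ZMod d) =
          (Rat.HeightOneSpectrum.natGenerator v : ZMod p)
        then sFactor p (Rat.HeightOneSpectrum.natGenerator v) else 0)) = delta W p v := by
  set ℓ := Rat.HeightOneSpectrum.natGenerator v with hℓdef
  have hpp := hp.out
  have key := lineChars_natCast_of_not_hasSplitMultiplicativeReductionAtPrime (W := W)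
    (coe_primesEquiv_eq_natGenerator v) hℓp hℓ2 hmult hns hΦ φ hℓm ψ hℓd hφ0 hψ0
  have hℓv : ((ℓ : ℕ) : 𝓞 ℚ) ∈ v.asIdeal := natCast_mem_asIdeal_of_primesEquiv_eq (coe_primesEquiv_eq_natGenerator v)
  have hmultAt : W.HasMultiplicativeReductionAt v :=
    GreenbergVatsalStrictSelmerMultiplicative.hasMultiplicativeReductionAt_of_mem W ℓ hmult hℓv
  have hnsAt : ¬ W.HasSplitMultiplicativeReductionAt v := fun h ↦
    hns ((W.hasSplitMultiplicativeReductionAtPrime_iff_hasSplitMultiplicativeReductionAt v).mpr h)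
  -- `−ℓ̄ ≠ ℓ̄` in `𝔽_p` (`p` odd, `p ∤ ℓ`)
  have hℓ0 : (ℓ : ZMod p) ≠ 0 := by
    rw [Ne, ZMod.natCast_eq_zero_iff]
    intro h
    exact hℓp ((Nat.prime_dvd_prime_iff_eq hpp hℓ.out).mp h).symm
  have hneg : -(ℓ : ZMod p) ≠ (ℓ : ZMod p) := by
    intro h
    have h2 : (2 : ZMod p) * (ℓ : ZMod p) = 0 := by linear_combination -h
    rcases mul_eq_zero.mp h2 with h2' | h2'
    · rw [show (2 : ZMod p) = ((2 : ℕ) : ZMod p) by norm_cast, ZMod.natCast_eq_zero_iff] at h2'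
      exact hp2 ((Nat.prime_dvd_prime_iff_eq hpp Nat.prime_two).mp h2')
    · exact hℓ0 h2'
  rw [delta_eq, LocalDeltaCalculus.dMultiplicity_of_hasNonsplitMultiplicativeReductionAt hmultAt hnsAt, ← hℓdef]
  rcases key with ⟨h1, h2⟩ | ⟨h1, h2⟩
  · rw [h1, h2, if_neg hneg]
    by_cases h : (ℓ : ZMod p) = -1
    · rw [if_pos h.symm, if_pos h]; ring
    · rw [if_neg (Ne.symm h), if_neg h]; ring
  · rw [h1, h2, if_neg hneg]
    by_cases h : (ℓ : ZMod p) = -1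
    · rw [if_pos h.symm, if_pos h]; ring
    · rw [if_neg (Ne.symm h), if_neg h]; ring


/-! ## Additive places where both characters are ramified, and the sum over `S₀` -/

omit [W.IsElliptic] hp in
/-- A Dirichlet character mod `m` vanishes at a prime `ℓ ∣ m`. [folklore] -/
theorem dirichletCharacter_natCast_eq_zero_of_dvd {R : Type*} [CommMonoidWithZero R] {m : ℕ}
    [NeZero m] (χ : DirichletCharacter R m) {ℓ : ℕ} (hℓ : ℓ.Prime) (hℓm : ℓ ∣ m) :
    χ (ℓ : ZMod m) = 0 := by
  apply MulChar.map_nonunit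
  rw [ZMod.isUnit_iff_coprime]
  intro h
  have h1 : ℓ ∣ Nat.gcd ℓ m := Nat.dvd_gcd dvd_rfl hℓm
  rw [h] at h1
  exact hℓ.one_lt.ne' (Nat.dvd_one.mp h1)

omit [W.IsElliptic] in
/-- **ADDITIVE place with both characters ramified at `ℓ` (`ℓ ∣ m`, `ℓ ∣ d`), `ℓ ≠ p`: the
door's balance term at `v` vanishes, as does `δ_W^{(v)}`** (`X2/LocalDeltaCalculus`: Euler factor
`1` at an additive place). This is the case of every prime `ℓ ∣ d_K` of the admissible twist
(potentially good, `e = 2`: both twisted characters carry `χ_{d_K}`), and of every additive prime of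
potentially multiplicative type. [cite: GreenbergVatsal2000, §2 Prop. (2.4) (p. 22) and p. 27] -/
theorem balanceTerm_of_hasAdditiveReductionAt_of_dvd {v : HeightOneSpectrum (𝓞 ℚ)}
    (hℓp : Rat.HeightOneSpectrum.natGenerator v ≠ p) (hadd : W.HasAdditiveReductionAt v)
    {m : ℕ} [NeZero m] (φ : DirichletCharacter (ZMod p) m) (hℓm : Rat.HeightOneSpectrum.natGenerator v ∣ m)
    {d : ℕ} [NeZero d] (ψ : DirichletCharacter (ZMod p) d) (hℓd : Rat.HeightOneSpectrum.natGenerator v ∣ d) :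
    ((if φ (Rat.HeightOneSpectrum.natGenerator v : ZMod m) =
          (Rat.HeightOneSpectrum.natGenerator v : ZMod p)
        then sFactor p (Rat.HeightOneSpectrum.natGenerator v) else 0) +
      (if ψ (Rat.HeightOneSpectrum.natGenerator v : ZMod d) =
          (Rat.HeightOneSpectrum.natGenerator v : ZMod p)
        then sFactor p (Rat.HeightOneSpectrum.natGenerator v) else 0)) = delta W p v := by
  set ℓ := Rat.HeightOneSpectrum.natGenerator v with hℓdef
  have hℓ : ℓ.Prime := (Rat.HeightOneSpectrum.primesEquiv v).2
  have hℓ0 : (0 : ZMod p) ≠ (ℓ : ZMod p) := by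
    intro h
    have h' := ((ZMod.natCast_eq_zero_iff ℓ p).mp h.symm)
    exact hℓp ((Nat.prime_dvd_prime_iff_eq hp.out hℓ).mp h').symm
  rw [LocalDeltaCalculus.delta_of_hasAdditiveReductionAt hadd,
    dirichletCharacter_natCast_eq_zero_of_dvd φ hℓ hℓm, dirichletCharacter_natCast_eq_zero_of_dvd ψ hℓ hℓd,
    if_neg hℓ0, add_zero]

omit [W.IsElliptic] hp in
/-- **Summing over `S₀`.** If at every place `v ∈ S₀` the door's balance term equals
`δ_W^{(v)} + e(v)` for some `e : S₀ → ℕ` (by the three evaluations above: `e = s_ℓ` at a split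
multiplicative, `0` at a non-split multiplicative, `0` at an additive place with both characters
ramified; otherwise the raw indicator term minus `0`), then the balance `n + Σ_{S₀} δ = Σ_{S₀} term`
holds iff `n = Σ_{S₀} e` — for the door (`n = 1`): «exactly one unit of excess», e.g. exactly one
split multiplicative `ℓ ≠ p` in `S₀`, with `s_ℓ = 1`, and nothing else. [cite: GreenbergVatsal2000, §2 Prop. (2.4) (p. 22) and §3 p. 43] -/
theorem balance_iff_of_forall_term_eq (S₀ : Finset (HeightOneSpectrum (𝓞 ℚ)))
    (term e : HeightOneSpectrum (𝓞 ℚ) → ℕ) (hterm : ∀ v ∈ S₀, term v = delta W p v + e v) (n : ℕ) :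
    n + ∑ v ∈ S₀, delta W p v = ∑ v ∈ S₀, term v ↔ n = ∑ v ∈ S₀, e v := by
  rw [Finset.sum_congr rfl hterm, Finset.sum_add_distrib]
  omega

end Summit.BirchSwinnertonDyer.BirchSwinnertonDyer.Theorems.EisensteinPrimesLocalBalanceAtMultiplicativePlace

end
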